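import Summits.QuantumFields.GaugeBoot.ZdCentralTwistLoops
import HarnessLib

/-!
# The staggered central twist on EVERY closed loop of the even torus: contractible loops, loops
# with winding, Polyakov lines and their correlators (gauge-boot, L3 structural supplement;
# `ℤ^d` twist 12)

HONEST FRAMING (cell `pub-gaugeboot`, page 1 of every file): the venture produces certified bounds
on lattice expectations at stated coupling, gauge group, dimension and torus size; NOT a mass gap,
NOT a continuum limit, NOT a string tension; NOT Yang–Mills-summit-bearing (barriers
`FixedCouplingUltralocality`, `PerturbativeInvisibility`). This module bounds no expectation; no
certificate of the cell sits at `β < 0` (a mirror value at `-β` obtained from a torus expectation at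
`β` by the sign rule below is a COROLLARY of that expectation, not a new certificate, and only for
`SU(2n)` / `U(N)`).

`CubicTorusWilsonLoopBetaFlip.lean` proved the torus sign rule for RECTANGLES
(`⟨W̄(R×T)⟩_{-β} = (-1)^{RT} ⟨W̄(R×T)⟩_β`), parts 8–9 (`ZdCentralTwistWalks/Loops`) the `ℤ^d` rule
for every closed walk (`W_C ↦ (-1)^{a(C)} W_C`, `a(C)` the lattice area parity), and part 4
(`ZdCentralTwistLimitPoints`) that the periodic lift intertwines the torus twist with the `ℤ^d`
twist (`torusLift_centralTwist_stagTwist`). A closed loop of the torus `(ℤ/L)^d` is the projection of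
a `ℤ^d` walk `w : x ⟶ y` with `y ≡ x (mod L)` — contractible iff it can be taken closed (`y = x`),
otherwise `y = x + L v` with winding vector `v` — and its holonomy in the torus configuration `U` is
`hol_w(torusLift L U)`. This file draws the consequences for EVERY such loop, `L` even, `ρ z = -1`:

* `twistParity_eq_areaParity_of_parity_eq` — the collected parity of a walk whose endpoints have
  the same coordinate parities is its area parity `a(w) = ∑_{i<k} S_{ik}(w)` (whatever the axis
  `r`); `parity_eq_of_torusProj_eq` — endpoints congruent mod an even `L` have equal parities;
* `walkHolonomy_torusLift_centralTwist` (every walk: `z^{twistParity}`) and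
  `walkHolonomy_torusLift_centralTwist_of_proj_eq` (closed torus loops: `z^{a(w)}`);
* ★★ `wilsonExpectation_character_walkHolonomy_neg` — **`⟨χ_ρ(hol_w ∘ lift)⟩_{L,-β} =
  (-1)^{twistParity} ⟨χ_ρ(hol_w ∘ lift)⟩_{L,β}` for every walk**, ★★ `…_of_proj_eq` (closed torus
  loops: sign `(-1)^{a(w)}`), ★★ `wilsonExpectation_wilsonLoopObs_neg` (contractible loops = closed
  `ℤ^d` walks, the tree's `wilsonLoopObs` transported by `toTorusObservable`);
* ★★ `wilsonExpectation_prod_character_walkHolonomy_neg` — products of loop observables pick up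
  the product of their signs;
* `twistParity_lineWalk` (a straight walk of `n` steps collects `n · c(x, μ)`), hence ★★
  `walkHolonomy_torusLift_centralTwist_lineWalk_even` — **a POLYAKOV LINE (straight walk of even
  length, e.g. once around the even torus) is INVARIANT under the twist**, and ★★★
  `wilsonExpectation_prod_polyakovLines_neg` — **every product of Polyakov-line characters (Polyakov
  loop correlators) has the SAME expectation at `β` and at `-β`** on the even torus;
* the cell's groups `SU(2n)` / `U(N)`: sequel `ZdCentralTwistTorusLoopsGroups.lean`.

What is NOT claimed: nothing for odd `L` or `SU(2n+1)`; no bound; the dependence of the sign of a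
loop WITH WINDING on the chosen Kogut–Susskind staggering (the `H¹((ℤ/L)^d; ℤ/2)` classes) is the
sequel `TorusKSCochains.lean`, not this file. [folklore] bookkeeping (Kogut–Susskind 1975;
Li–Meurice 2005 §II; Polyakov loops: A. M. Polyakov, Phys. Lett. B 72 (1978) 477).
-/

noncomputable section

open MeasureTheory Filter Topology SimpleGraph
open Literature.Probability.LatticeModels (Site zdGraph Torus.proj Torus.proj_apply)
open Literature.MathematicalPhysics.QuantumLattice
open Literature.MathematicalPhysics.QuantumFieldTheory (GaugeConfig wilsonMeasure wilsonExpectation)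

namespace Summit.QuantumFields.GaugeBoot

namespace TiltedRP

variable {d N : ℕ} {G : Type*} [Group G]

/-! ## Walks whose endpoints have equal parities: the collected parity is the area parity -/

section ParityEq

variable {z : G} {π : Fin d → Site d →+ ZMod 2}

/-- **The collected parity of a walk `w : x ⟶ y` whose endpoints have the same coordinate parities
is its lattice area parity**, whatever the axis `r` put last (the correction terms
`S_{kr} + S_{rk} = π_kπ_r(y) - π_kπ_r(x)` vanish). Closed walks are the case `y = x`
(`twistParity_eq_areaParity`). -/
theorem twistParity_eq_areaParity_of_parity_eq (hπ : IsDualParity (zdUnit d) π) (r : Fin d)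
    {x y : Site d} (w : (zdGraph d).Walk x y) (hxy : ∀ m, π m y = π m x) :
    twistParity π r w = areaParity π w := by
  rw [twistParity_eq_areaParity_add r w, add_eq_left]
  refine Finset.sum_eq_zero fun k _ => ?_
  split_ifs with hk
  · rw [shoelaceParity_add_swap hπ (ne_of_gt hk) w, hxy k, hxy r, sub_self]
  · rfl

/-- Hence for such walks the collected parity does not depend on the axis put last. -/
theorem twistParity_eq_of_parity_eq (hπ : IsDualParity (zdUnit d) π) (r r' : Fin d)
    {x y : Site d} (w : (zdGraph d).Walk x y) (hxy : ∀ m, π m y = π m x) :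
    twistParity π r w = twistParity π r' w := by
  rw [twistParity_eq_areaParity_of_parity_eq hπ r w hxy,
    twistParity_eq_areaParity_of_parity_eq hπ r' w hxy]

/-- **`hol_w(T U) = z^{a(w)} · hol_w(U)`** for every walk whose endpoints have equal parities
(`z` central, `z² = 1`). -/
theorem walkHolonomy_centralTwist_stagTwist_of_parity_eq (hπ : IsDualParity (zdUnit d) π)
    (hzc : ∀ g : G, z * g = g * z) (hz2 : z * z = 1) (r : Fin d) (U : LGConfig d G)
    {x y : Site d} (w : (zdGraph d).Walk x y) (hxy : ∀ m, π m y = π m x) :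
    walkHolonomy (centralTwist (stagTwist π r z) U) w =
      zpow₂ z (areaParity π w) * walkHolonomy U w := by
  rw [walkHolonomy_centralTwist_stagTwist hπ hzc hz2 r U w,
    twistParity_eq_areaParity_of_parity_eq hπ r w hxy]

variable (ρ : G →* Matrix (Fin N) (Fin N) ℂ)

/-- **The character of the holonomy of EVERY walk under the twist**:
`χ_ρ(hol_w(T U)) = (-1)^{twistParity π r w} χ_ρ(hol_w(U))` (`χ_ρ = (1/N) Re tr ρ`, `ρ z = -1`). -/
theorem character_walkHolonomy_centralTwist (hπ : IsDualParity (zdUnit d) π)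
    (hzc : ∀ g : G, z * g = g * z) (hz2 : z * z = 1) (hρz : ρ z = -1) (r : Fin d)
    {x y : Site d} (w : (zdGraph d).Walk x y) (U : LGConfig d G) :
    normalisedCharacter N (ρ (walkHolonomy (centralTwist (stagTwist π r z) U) w)) =
      (-1 : ℝ) ^ (twistParity π r w).val * normalisedCharacter N (ρ (walkHolonomy U w)) := by
  simp only [normalisedCharacter]
  rw [walkHolonomy_centralTwist_stagTwist hπ hzc hz2 r U w, map_mul, rep_zpow₂ ρ hρz,
    smul_mul_assoc, one_mul, Matrix.trace_smul, Complex.smul_re, smul_eq_mul]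
  ring

/-- The same for walks with endpoints of equal parities: the sign is `(-1)^{a(w)}`. -/
theorem character_walkHolonomy_centralTwist_of_parity_eq (hπ : IsDualParity (zdUnit d) π)
    (hzc : ∀ g : G, z * g = g * z) (hz2 : z * z = 1) (hρz : ρ z = -1) (r : Fin d)
    {x y : Site d} (w : (zdGraph d).Walk x y) (hxy : ∀ m, π m y = π m x) (U : LGConfig d G) :
    normalisedCharacter N (ρ (walkHolonomy (centralTwist (stagTwist π r z) U) w)) =
      (-1 : ℝ) ^ (areaParity π w).val * normalisedCharacter N (ρ (walkHolonomy U w)) := by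
  rw [character_walkHolonomy_centralTwist ρ hπ hzc hz2 hρz r w U,
    twistParity_eq_areaParity_of_parity_eq hπ r w hxy]

end ParityEq

/-! ## Straight walks (Polyakov lines): `n` steps collect `n · c(x, μ)` -/

section Lines

variable {z : G} {π : Fin d → Site d →+ ZMod 2}

/-- The collected parity does not see `Walk.copy`. -/
@[simp] theorem twistParity_copy (r : Fin d) {x y x' y' : Site d} (p : (zdGraph d).Walk x y)
    (hx : x = x') (hy : y = y') : twistParity π r (p.copy hx hy) = twistParity π r p := by
  subst hx hy; rfl

/-- **A straight walk of `n` steps in direction `μ` collects `n · c(x, μ)`**: the staggered parity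
`c(·, μ)` is constant along the direction `μ` (`stagParity_add_e` with `μ ⊀ μ`). -/
theorem twistParity_lineWalk (hπ : IsDualParity (zdUnit d) π) (r μ : Fin d) :
    ∀ (n : ℕ) (x : Site d),
      twistParity π r (lineWalk μ n x) = (n : ZMod 2) * stagParity π r (x, μ)
  | 0, x => by simp [lineWalk]
  | n + 1, x => by
    rw [lineWalk, twistParity_cons, twistParity_copy, twistParity_lineWalk hπ r μ n, dartDir_add_single]
    have hc : stagParity π r (x + Pi.single μ 1, μ) = stagParity π r (x, μ) := by
      rw [← zdUnit_apply, stagParity_add_e hπ r x μ μ,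
        if_neg (fun h : PrecLast r μ μ => h.2.elim h.1 (lt_irrefl μ)), add_zero]
    rw [hc]
    push_cast
    ring

/-- **A straight walk of EVEN length collects nothing** (in particular a Polyakov line once around
the even torus). -/
theorem twistParity_lineWalk_of_even (hπ : IsDualParity (zdUnit d) π) (r μ : Fin d) {n : ℕ}
    (hn : Even n) (x : Site d) : twistParity π r (lineWalk μ n x) = 0 := by
  rw [twistParity_lineWalk hπ r μ n x, (ZMod.natCast_eq_zero_iff_even).2 hn, zero_mul]

/-- **`hol(T U) = hol(U)` along a straight walk of even length.** -/
theorem walkHolonomy_centralTwist_stagTwist_lineWalk_even (hπ : IsDualParity (zdUnit d) π)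
    (hzc : ∀ g : G, z * g = g * z) (hz2 : z * z = 1) (r μ : Fin d) {n : ℕ} (hn : Even n)
    (x : Site d) (U : LGConfig d G) :
    walkHolonomy (centralTwist (stagTwist π r z) U) (lineWalk μ n x) =
      walkHolonomy U (lineWalk μ n x) := by
  rw [walkHolonomy_centralTwist_stagTwist hπ hzc hz2 r U, twistParity_lineWalk_of_even hπ r μ hn]
  simp [zpow₂]

end Lines

/-! ## The even torus: every closed torus loop through the periodic lift -/

section Torus

variable {L : ℕ} {G : Type} [Group G] {z : G} {π : Fin d → Site d →+ ZMod 2}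

/-- **Endpoints congruent mod an even `L` have equal coordinate parities.** -/
theorem parity_eq_of_torusProj_eq (hπ : IsDualParity (zdUnit d) π) (h2 : 2 ∣ L) {x y : Site d}
    (hxy : Torus.proj L y = Torus.proj L x) (m : Fin d) : π m y = π m x := by
  rw [hπ.apply_zd, hπ.apply_zd, ZMod.intCast_eq_intCast_iff_dvd_sub]
  have h := congrFun hxy m
  simp only [Torus.proj_apply] at h
  rw [ZMod.intCast_eq_intCast_iff_dvd_sub] at h
  exact (Int.natCast_dvd_natCast.2 h2).trans h

/-- A straight walk once around the torus (`L` steps) returns to the same torus site. -/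
theorem torusProj_lineWalk_end (L : ℕ) (x : Site d) (μ : Fin d) :
    Torus.proj L (x + Pi.single μ (L : ℤ)) = Torus.proj L x := by
  rw [torusProj_add_single, Int.cast_natCast, ZMod.natCast_self, Pi.single_zero, add_zero]

/-- ★ **The holonomy of EVERY walk in the lift of the twisted torus configuration**:
`hol_w(lift(T_L U)) = z^{twistParity π r w} · hol_w(lift U)` (`L` even; the lift intertwines the
torus twist and the `ℤ^d` twist, part 4). -/
theorem walkHolonomy_torusLift_centralTwist (hπ : IsDualParity (zdUnit d) π) (h2 : 2 ∣ L)
    (hzc : ∀ g : G, z * g = g * z) (hz2 : z * z = 1) (r : Fin d) (U : GaugeConfig d L G)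
    {x y : Site d} (w : (zdGraph d).Walk x y) :
    walkHolonomy (torusLift L (centralTwist (stagTwist (cubicParity d L h2) r z) U)) w =
      zpow₂ z (twistParity π r w) * walkHolonomy (torusLift L U) w := by
  rw [torusLift_centralTwist_stagTwist hπ h2, walkHolonomy_centralTwist_stagTwist hπ hzc hz2 r]

/-- ★ **Closed torus loops** (walks `w : x ⟶ y` of `ℤ^d` with `y ≡ x (mod L)`, contractible or not):
`hol_w(lift(T_L U)) = z^{a(w)} · hol_w(lift U)` with `a(w)` the area parity of `w`. -/
theorem walkHolonomy_torusLift_centralTwist_of_proj_eq (hπ : IsDualParity (zdUnit d) π)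
    (h2 : 2 ∣ L) (hzc : ∀ g : G, z * g = g * z) (hz2 : z * z = 1) (r : Fin d)
    (U : GaugeConfig d L G) {x y : Site d} (w : (zdGraph d).Walk x y)
    (hxy : Torus.proj L y = Torus.proj L x) :
    walkHolonomy (torusLift L (centralTwist (stagTwist (cubicParity d L h2) r z) U)) w =
      zpow₂ z (areaParity π w) * walkHolonomy (torusLift L U) w := by
  rw [walkHolonomy_torusLift_centralTwist hπ h2 hzc hz2 r U w,
    twistParity_eq_areaParity_of_parity_eq hπ r w (parity_eq_of_torusProj_eq hπ h2 hxy)]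

/-- ★★ **A Polyakov line is invariant under the torus twist**: the holonomy once around the even
torus in direction `μ` (the straight walk of `L` steps from `x`, read in the lift) is the same for
`T_L U` and for `U`. -/
theorem walkHolonomy_torusLift_centralTwist_lineWalk_even (hπ : IsDualParity (zdUnit d) π)
    (h2 : 2 ∣ L) (hzc : ∀ g : G, z * g = g * z) (hz2 : z * z = 1) (r μ : Fin d) {n : ℕ}
    (hn : Even n) (x : Site d) (U : GaugeConfig d L G) :
    walkHolonomy (torusLift L (centralTwist (stagTwist (cubicParity d L h2) r z) U)) (lineWalk μ n x) =
      walkHolonomy (torusLift L U) (lineWalk μ n x) := by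
  rw [torusLift_centralTwist_stagTwist hπ h2,
    walkHolonomy_centralTwist_stagTwist_lineWalk_even hπ hzc hz2 r μ hn]

variable [TopologicalSpace G] [IsTopologicalGroup G] [CompactSpace G] [MeasurableSpace G]
  [BorelSpace G] [SecondCountableTopology G]
variable (ρ : G →* Matrix (Fin N) (Fin N) ℂ)

/-- ★★ **Every walk, expectation form**: `⟨χ_ρ(hol_w ∘ lift)⟩_{L,-β} =
(-1)^{twistParity π r w} ⟨χ_ρ(hol_w ∘ lift)⟩_{L,β}` on the even torus `(ℤ/L)^d` (`ρ` continuous,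
`ρ z = -1`, every real `β`). For a walk that does not close up on the torus both sides are
expectations of a gauge-variant quantity; the identity holds regardless. -/
theorem wilsonExpectation_character_walkHolonomy_neg [NeZero L] (hπ : IsDualParity (zdUnit d) π)
    (h2 : 2 ∣ L) (r : Fin d) (hρ : Continuous ρ) (hzc : ∀ g : G, z * g = g * z) (hz2 : z * z = 1)
    (hρz : ρ z = -1) (β : ℝ) {x y : Site d} (w : (zdGraph d).Walk x y) :
    wilsonExpectation (L := L) ρ (-β)
        (fun U => normalisedCharacter N (ρ (walkHolonomy (torusLift L U) w))) =
      (-1 : ℝ) ^ (twistParity π r w).val *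
        wilsonExpectation (L := L) ρ β
          (fun U => normalisedCharacter N (ρ (walkHolonomy (torusLift L U) w))) := by
  have h := wilsonExpectation_toTorusObservable_comp_centralTwist ρ hπ h2 r hρ hzc hz2 hρz β
    (fun V : LGConfig d G => normalisedCharacter N (ρ (walkHolonomy V w)))
  rw [show (fun U : GaugeConfig d L G => normalisedCharacter N (ρ (walkHolonomy (torusLift L U) w))) =
      toTorusObservable L (fun V : LGConfig d G => normalisedCharacter N (ρ (walkHolonomy V w)))
      from rfl, ← h]
  unfold wilsonExpectation
  rw [← integral_const_mul]
  refine integral_congr_ae (ae_of_all _ fun U => ?_)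
  simp only [toTorusObservable_apply, Function.comp_apply]
  exact character_walkHolonomy_centralTwist ρ hπ hzc hz2 hρz r w _

/-- ★★ **Every CLOSED TORUS LOOP, expectation form**: for a walk `w : x ⟶ y` of `ℤ^d` with
`y ≡ x (mod L)` (a closed loop of the torus, contractible or with winding),
`⟨χ_ρ(hol_w ∘ lift)⟩_{L,-β} = (-1)^{a(w)} ⟨χ_ρ(hol_w ∘ lift)⟩_{L,β}`. -/
theorem wilsonExpectation_character_walkHolonomy_neg_of_proj_eq [NeZero L]
    (hπ : IsDualParity (zdUnit d) π) (h2 : 2 ∣ L) (hρ : Continuous ρ)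
    (hzc : ∀ g : G, z * g = g * z) (hz2 : z * z = 1) (hρz : ρ z = -1) (β : ℝ) {x y : Site d}
    (w : (zdGraph d).Walk x y) (hxy : Torus.proj L y = Torus.proj L x) :
    wilsonExpectation (L := L) ρ (-β)
        (fun U => normalisedCharacter N (ρ (walkHolonomy (torusLift L U) w))) =
      (-1 : ℝ) ^ (areaParity π w).val *
        wilsonExpectation (L := L) ρ β
          (fun U => normalisedCharacter N (ρ (walkHolonomy (torusLift L U) w))) := by
  classical
  rcases isEmpty_or_nonempty (Fin d) with hd | ⟨⟨r⟩⟩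
  · -- `d = 0`: no directions, so `w` has no darts: `hol_w = 1` and `a(w) = 0`
    have hC : w.darts = [] := by
      rcases hC' : w.darts with _ | ⟨e, _⟩
      · rfl
      · exact (hd.false (dartDir e)).elim
    have hA : areaParity π w = 0 := Finset.sum_eq_zero fun i _ => (hd.false i).elim
    have hw : ∀ V : LGConfig d G, walkHolonomy V w = 1 := fun V => by simp [walkHolonomy, hC]
    haveI := Literature.MathematicalPhysics.QuantumFieldTheory.isProbabilityMeasure_wilsonMeasure
      (d := d) (L := L) ρ hρ β
    haveI := Literature.MathematicalPhysics.QuantumFieldTheory.isProbabilityMeasure_wilsonMeasure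
      (d := d) (L := L) ρ hρ (-β)
    simp [wilsonExpectation, hw, hA]
  · rw [wilsonExpectation_character_walkHolonomy_neg ρ hπ h2 r hρ hzc hz2 hρz β w,
      twistParity_eq_areaParity_of_parity_eq hπ r w (parity_eq_of_torusProj_eq hπ h2 hxy)]

/-- ★★ **Every CONTRACTIBLE torus loop** — a closed walk `C` of `ℤ^d` read on the torus through the
periodic lift (the tree's `wilsonLoopObs` transported by `toTorusObservable`):
`⟨W_C ∘ lift⟩_{L,-β} = (-1)^{a(C)} ⟨W_C ∘ lift⟩_{L,β}`, `L` even — the loop-general form of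
`CubicTorusWilsonLoopBetaFlip`'s rectangle rule. -/
theorem wilsonExpectation_wilsonLoopObs_neg [NeZero L] (hπ : IsDualParity (zdUnit d) π)
    (h2 : 2 ∣ L) (r : Fin d) (hρ : Continuous ρ) (hzc : ∀ g : G, z * g = g * z) (hz2 : z * z = 1)
    (hρz : ρ z = -1) (β : ℝ) {x : Site d} (C : (zdGraph d).Walk x x) :
    wilsonExpectation (L := L) ρ (-β)
        (toTorusObservable L (wilsonLoopObs (normalisedCharacter N ∘ ρ) C)) =
      (-1 : ℝ) ^ (areaParity π C).val *
        wilsonExpectation (L := L) ρ β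
          (toTorusObservable L (wilsonLoopObs (normalisedCharacter N ∘ ρ) C)) := by
  have h := wilsonExpectation_character_walkHolonomy_neg ρ hπ h2 r hρ hzc hz2 hρz β C
  rw [twistParity_eq_areaParity hπ r C] at h
  exact h

/-- ★★ **Products of loop observables** (several walks `w_a : x_a ⟶ y_a`, e.g. several torus loops):
`⟨∏_a χ_ρ(hol_{w_a} ∘ lift)⟩_{L,-β} = (-1)^{∑_a twistParity π r (w_a)} ⟨∏_a χ_ρ(hol_{w_a} ∘ lift)⟩_{L,β}`. -/
theorem wilsonExpectation_prod_character_walkHolonomy_neg [NeZero L]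
    (hπ : IsDualParity (zdUnit d) π) (h2 : 2 ∣ L) (r : Fin d) (hρ : Continuous ρ)
    (hzc : ∀ g : G, z * g = g * z) (hz2 : z * z = 1) (hρz : ρ z = -1) (β : ℝ) {n : ℕ}
    {x y : Fin n → Site d} (w : ∀ a, (zdGraph d).Walk (x a) (y a)) :
    wilsonExpectation (L := L) ρ (-β)
        (fun U => ∏ a, normalisedCharacter N (ρ (walkHolonomy (torusLift L U) (w a)))) =
      (-1 : ℝ) ^ (∑ a, (twistParity π r (w a)).val) *
        wilsonExpectation (L := L) ρ β
          (fun U => ∏ a, normalisedCharacter N (ρ (walkHolonomy (torusLift L U) (w a)))) := by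
  have h := wilsonExpectation_toTorusObservable_comp_centralTwist ρ hπ h2 r hρ hzc hz2 hρz β
    (fun V : LGConfig d G => ∏ a, normalisedCharacter N (ρ (walkHolonomy V (w a))))
  rw [show (fun U : GaugeConfig d L G =>
        ∏ a, normalisedCharacter N (ρ (walkHolonomy (torusLift L U) (w a)))) =
      toTorusObservable L (fun V : LGConfig d G => ∏ a, normalisedCharacter N (ρ (walkHolonomy V (w a))))
      from rfl, ← h]
  unfold wilsonExpectation
  rw [← integral_const_mul]
  refine integral_congr_ae (ae_of_all _ fun U => ?_)
  simp only [toTorusObservable_apply, Function.comp_apply,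
    character_walkHolonomy_centralTwist ρ hπ hzc hz2 hρz r, Finset.prod_mul_distrib,
    Finset.prod_pow_eq_pow_sum]

/-- ★★★ **Polyakov loop correlators are EVEN in `β` on the even torus.** For any finite family of
Polyakov lines (straight walks of `L` steps in directions `μ_a` from sites `x_a`, i.e. once around
the even torus `(ℤ/L)^d`), the expectation of the product of their characters
`∏_a χ_ρ(P_{μ_a}(x_a))` is the same at `β` and at `-β` (`ρ` continuous, `ρ z = -1`; each line
collects `L · c(x_a, μ_a) = 0`). The single line (`n = 1`) is the Polyakov loop itself. -/
theorem wilsonExpectation_prod_polyakovLines_neg [NeZero L] (hπ : IsDualParity (zdUnit d) π)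
    (h2 : 2 ∣ L) (r : Fin d) (hρ : Continuous ρ) (hzc : ∀ g : G, z * g = g * z) (hz2 : z * z = 1)
    (hρz : ρ z = -1) (β : ℝ) {n : ℕ} (μ : Fin n → Fin d) (x : Fin n → Site d) :
    wilsonExpectation (L := L) ρ (-β)
        (fun U => ∏ a, normalisedCharacter N (ρ (walkHolonomy (torusLift L U) (lineWalk (μ a) L (x a))))) =
      wilsonExpectation (L := L) ρ β
        (fun U => ∏ a, normalisedCharacter N (ρ (walkHolonomy (torusLift L U) (lineWalk (μ a) L (x a))))) := by
  rw [wilsonExpectation_prod_character_walkHolonomy_neg ρ hπ h2 r hρ hzc hz2 hρz β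
    (fun a => lineWalk (μ a) L (x a))]
  simp only [twistParity_lineWalk_of_even hπ r _ (even_iff_two_dvd.2 h2), ZMod.val_zero,
    Finset.sum_const_zero, pow_zero, one_mul]

/-- **A single Polyakov line**: `⟨χ_ρ(P_μ(x))⟩_{L,-β} = ⟨χ_ρ(P_μ(x))⟩_{L,β}` on the even torus. -/
theorem wilsonExpectation_polyakovLine_neg [NeZero L] (hπ : IsDualParity (zdUnit d) π)
    (h2 : 2 ∣ L) (r : Fin d) (hρ : Continuous ρ) (hzc : ∀ g : G, z * g = g * z) (hz2 : z * z = 1)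
    (hρz : ρ z = -1) (β : ℝ) (μ : Fin d) (x : Site d) :
    wilsonExpectation (L := L) ρ (-β)
        (fun U => normalisedCharacter N (ρ (walkHolonomy (torusLift L U) (lineWalk μ L x)))) =
      wilsonExpectation (L := L) ρ β
        (fun U => normalisedCharacter N (ρ (walkHolonomy (torusLift L U) (lineWalk μ L x)))) := by
  rw [wilsonExpectation_character_walkHolonomy_neg ρ hπ h2 r hρ hzc hz2 hρz β,
    twistParity_lineWalk_of_even hπ r μ (even_iff_two_dvd.2 h2) x, ZMod.val_zero, pow_zero, one_mul]

end Torus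

end TiltedRP

end Summit.QuantumFields.GaugeBoot
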